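import Literature.AlgebraicGeometry.Resolution.InvariantsTrivialInertiaDescent
import Literature.AlgebraicGeometry.Resolution.LocAtCentreSubfieldTransport
import Mathlib.GroupTheory.QuotientGroup.Basic
import HarnessLib

/-!
# The fixed local model of a finite group acting with trivial inertia is regular ([CoP1] Prop. 9.3, inertia layer: "`S₀ˢ` is regular")

Topic: `Literature/AlgebraicGeometry/Resolution`. PROOF side of `CossartPiltant2019ReductionP`
(`ArithmeticalThreefoldsLocal.lean`), input (C4), inertia layer of [CoP1] Prop. 9.3 (hypothesis
`hInert` of `cossartPiltant2019ReductionP_of_cjs_of_layers`,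
`ArithmeticalThreefoldsLocalDescentLayers.lean`). The printed sentence (HAL p. 27):

> the unique normal local model `S₀ⁱ` of `W ∩ Kⁱ/k` lying above `S₀′` is regular. Now, the
> invariant ring `S₀ˢ := (S₀ⁱ)^{Gˢ(W/V)/Gⁱ(W/V)} ⊂ Kˢ` is a normal local model of `Vˢ/k` … and
> `S₀ⁱ` is local-étale over `S₀ˢ`, so that `S₀ˢ` is regular.

`InvariantsTrivialInertiaDescent.lean` proved the abstract descent ("a finite group acting on a
regular local ring with trivial inertia has a regular ring of invariants"). This file puts it in
the tree's currency of local models inside a valued field (`locAtCentre`, `LocalBlowup.lean`):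
for a finite group `G` acting on a field `F` by automorphisms preserving a valuation ring `O`
(`G ≤ Gˢ`, the decomposition group) and a `G`-stable subring `B ⊆ O`,

* `isRegularLocalRing_of_trivial_or_isUnit_smul_sub` — PROVED: the abstract descent for an
  action with KERNEL (every `g` acts trivially OR moves some element by a unit: the action of
  `Gˢ` on a model of the inertia field `Kⁱ` has kernel `Gⁱ`), by passing to `G ⧸ kernel`;
* `valuation_smul_eq_one`, `smul_mem_locAtCentre_of_stable` — PROVED: `G` preserves the units of
  `O` and acts on the local ring `B_{𝔪_O ∩ B}` of a stable `B`;
* `locAtCentre_inf_fixedPoints_eq` — PROVED: **`(B_{𝔪 ∩ B})^G = (B^G)_{𝔪 ∩ B^G}`** inside `F`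
  (the finite-group version of `locAtCentre_inf_fixedSubring_eq`, `TameCyclicFixedModel.lean`:
  an invariant `y/z` is `y′/N(z)` with `N(z) = ∏_g g•z ∈ B^G` of value `0`);
* `isRegularLocalRing_locAtCentre_inf_fixedPoints` — PROVED: **if `B_{𝔪 ∩ B}` is regular and
  every `g ∈ G` either fixes `B` pointwise or moves some element of `B_{𝔪 ∩ B}` by a unit of
  `O` (trivial inertia modulo the kernel), then the fixed local model `(B^G)_{𝔪 ∩ B^G}` is
  regular** — "`S₀ˢ` is regular".

Everything is PROVED; no named facts, definitions, instances or notation are introduced.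

## Sources

* V. Cossart, O. Piltant, J. Algebra 320 (2008) 1051–1082: proof of Prop. 9.3 (HAL
  hal-00139124, p. 27) and of Lemma 9.4 (p. 29, "`R₁ := S₁^G` is a normal local model").
  [CossartPiltant2008]
* S. U. Chase, D. K. Harrison, A. Rosenberg, Mem. AMS 52 (1965), Thm. 1.3.
  [ChaseHarrisonRosenberg1965]
* H. Matsumura, *Commutative Ring Theory* (1986), Thm. 23.7 (i). [Matsumura1987]
* O. Zariski, P. Samuel, *Commutative Algebra* II (1960), Ch. VI §12 (3), p. 69.
  [ZariskiSamuel1960]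
-/

noncomputable section

namespace Literature.AlgebraicGeometry.Resolution

universe u v

open IsLocalRing

/-! ## The abstract descent for an action with kernel -/

section Kernel

variable {R C : Type u} [CommRing R] [CommRing C] [Algebra R C]
  {G : Type v} [Group G] [Fintype G] [MulSemiringAction G C]

/-- **Regularity descends to the invariants, action with kernel.** If the finite group `G` acts
on the regular local ring `C` so that every `g ∈ G` either acts trivially or moves some element
by a unit (trivial inertia of `G/ker`), and `R → C` is injective onto the invariants, then `R` is
a regular local ring — `InvariantsTrivialInertiaDescent`'s `isRegularLocalRing_of_isUnit_smul_sub`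
for the faithful action of `G ⧸ ker`. [cite: CossartPiltant2008, proof of Prop. 9.3 (HAL p. 27), "`S₀ˢ := (S₀ⁱ)^{Gˢ/Gⁱ}` … is regular"] -/
theorem isRegularLocalRing_of_trivial_or_isUnit_smul_sub [IsRegularLocalRing C]
    (hGR : ∀ (g : G) (r : R), g • algebraMap R C r = algebraMap R C r)
    (hfix : ∀ c : C, (∀ g : G, g • c = c) → c ∈ Set.range (algebraMap R C))
    (hinj : Function.Injective (algebraMap R C))
    (hI : ∀ g : G, (∀ c : C, g • c = c) ∨ ∃ c : C, IsUnit (g • c - c)) :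
    IsRegularLocalRing R := by
  classical
  let f : G →* RingAut C := MulSemiringAction.toRingAut G C
  let Q := G ⧸ f.ker
  letI : MulSemiringAction Q C := MulSemiringAction.compHom C (QuotientGroup.kerLift f)
  letI : Fintype Q := Fintype.ofFinite Q
  have hQ : ∀ (g : G) (c : C), (g : Q) • c = g • c := fun g c => rfl
  refine isRegularLocalRing_of_isUnit_smul_sub (G := Q) (R := R) (C := C) ?_ ?_ hinj ?_
  · intro q r
    obtain ⟨g, rfl⟩ := QuotientGroup.mk_surjective q
    rw [hQ]
    exact hGR g r
  · intro c hc
    exact hfix c fun g => by rw [← hQ]; exact hc g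
  · intro q hq
    obtain ⟨g, rfl⟩ := QuotientGroup.mk_surjective q
    have hg : g ∉ f.ker := fun h => hq ((QuotientGroup.eq_one_iff g).mpr h)
    rcases hI g with h | ⟨c, hc⟩
    · refine absurd ?_ hg
      rw [MonoidHom.mem_ker]
      ext c
      exact h c
    · exact ⟨c, by rw [hQ]; exact hc⟩

end Kernel

/-! ## Local models in a valued field with a finite group of automorphisms -/

section FixedModel

variable {F : Type u} [Field F] (O : ValuationSubring F)
  {G : Type v} [Group G] [Fintype G] [MulSemiringAction G F]

omit [Fintype G] in
/-- An automorphism preserving the valuation ring preserves its units: `v(z) = 0 ⇒ v(g•z) = 0`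
(written multiplicatively, `O.valuation z = 1`) — the unit case of Zariski–Samuel's (3),
"`v(σ x) = v(x)` for `σ` in the decomposition group". [cite: ZariskiSamuel1960, Ch. VI §12 (3), p. 69] -/
theorem valuation_smul_eq_one (hGO : ∀ (g : G) (x : F), x ∈ O → g • x ∈ O) (g : G) {z : F}
    (hz : O.valuation z = 1) : O.valuation (g • z) = 1 := by
  have hz0 : z ≠ 0 := ne_zero_of_valuation_eq_one hz
  have hgz0 : g • z ≠ 0 := fun h => hz0 (by simpa using congrArg (fun x => g⁻¹ • x) h)
  have h1 : g • z ∈ O := hGO g z ((O.valuation_le_one_iff z).mp hz.le)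
  have h2 : (g • z)⁻¹ ∈ O := by
    rw [← smul_inv'' g z]
    refine hGO g _ ((O.valuation_le_one_iff _).mp ?_)
    rw [map_inv₀, hz, inv_one]
  refine le_antisymm ((O.valuation_le_one_iff _).mpr h1) ?_
  have h3 := (O.valuation_le_one_iff _).mpr h2
  rw [map_inv₀] at h3
  exact (inv_le_one₀ (zero_lt_iff.mpr ((Valuation.ne_zero_iff _).mpr hgz0))).mp h3

omit [Fintype G] in
/-- `G` acts on the local ring at the centre `B_{𝔪_O ∩ B}` of a `G`-stable subring `B`:
`g•(y/z) = (g•y)/(g•z)` with `v(g•z) = 0`. [cite: CossartPiltant2008, proof of Lemma 9.4 (HAL p. 29)] -/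
theorem smul_mem_locAtCentre_of_stable (hGO : ∀ (g : G) (x : F), x ∈ O → g • x ∈ O)
    {B : Subring F} (hB : ∀ (g : G), ∀ x ∈ B, g • x ∈ B) (g : G) {x : F}
    (hx : x ∈ locAtCentre B O) : g • x ∈ locAtCentre B O := by
  obtain ⟨y, hy, z, hz, hvz, rfl⟩ := mem_locAtCentre_iff.mp hx
  refine ⟨g • y, hB g y hy, g • z, hB g z hz, valuation_smul_eq_one O hGO g hvz, ?_⟩
  rw [div_eq_mul_inv, smul_mul', smul_inv'', div_eq_mul_inv]

/-- **Invariants commute with localisation at the centre of a stable valuation**: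
`(B_{𝔪_O ∩ B}) ∩ F^G = (B ∩ F^G)_{𝔪_O ∩ (B ∩ F^G)}` inside `F`, for a finite group `G`
preserving `O` and a `G`-stable subring `B`. An invariant fraction `y/z` (`y, z ∈ B`, `v(z) = 0`)
is `y′/z′` with `z′ = ∏_g g•z ∈ B^G` of value `0` (the norm of the denominator) and
`y′ = (y/z)·z′ = y·∏_{g ≠ 1} g•z ∈ B^G` ("`R₁ := S₁^G` … is a normal local model of `V/k`").
[cite: CossartPiltant2008, proof of Lemma 9.4 (HAL p. 29) and of Prop. 9.3 (p. 27)] -/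
theorem locAtCentre_inf_fixedPoints_eq (hGO : ∀ (g : G) (x : F), x ∈ O → g • x ∈ O)
    {B : Subring F} (hB : ∀ (g : G), ∀ x ∈ B, g • x ∈ B) :
    locAtCentre B O ⊓ FixedPoints.subring F G = locAtCentre (B ⊓ FixedPoints.subring F G) O := by
  classical
  have hmem : ∀ x : F, x ∈ FixedPoints.subring F G ↔ ∀ g : G, g • x = x := fun x => Iff.rfl
  apply le_antisymm
  · rintro x ⟨hxB, hxG⟩
    replace hxG : ∀ g : G, g • x = x := (hmem x).mp hxG
    obtain ⟨y, hy, z, hz, hvz, rfl⟩ := mem_locAtCentre_iff.mp hxB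
    have hz0 : z ≠ 0 := ne_zero_of_valuation_eq_one hvz
    -- the norm of the denominator
    set z' : F := ∏ g : G, g • z with hz'def
    have hz'B : z' ∈ B := Subring.prod_mem _ fun g _ => hB g z hz
    have hz'G : ∀ h : G, h • z' = z' := fun h => by
      rw [hz'def, Finset.smul_prod', ← Equiv.prod_comp (Equiv.mulLeft h⁻¹)]
      refine Finset.prod_congr rfl fun g _ => ?_
      rw [Equiv.coe_mulLeft, smul_smul, mul_inv_cancel_left]
    have hvz' : O.valuation z' = 1 := by
      rw [hz'def, map_prod]
      exact Finset.prod_eq_one fun g _ => valuation_smul_eq_one O hGO g hvz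
    have hz'0 : z' ≠ 0 := ne_zero_of_valuation_eq_one hvz'
    -- `z' = z * ∏_{g ≠ 1} g•z`
    set z'' : F := ∏ g ∈ Finset.univ.erase (1 : G), g • z with hz''def
    have hz'eq : z' = z * z'' := by
      rw [hz'def, hz''def, ← Finset.mul_prod_erase Finset.univ (fun g : G => g • z)
        (Finset.mem_univ 1), one_smul]
    have hz''B : z'' ∈ B := Subring.prod_mem _ fun g _ => hB g z hz
    -- the new numerator
    set y' : F := y / z * z' with hy'def
    have hy'eq : y' = y * z'' := by
      rw [hy'def, hz'eq]; field_simp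
    have hy'B : y' ∈ B := by rw [hy'eq]; exact B.mul_mem hy hz''B
    have hy'G : ∀ h : G, h • y' = y' := fun h => by rw [hy'def, smul_mul', hxG h, hz'G h]
    refine ⟨y', ⟨hy'B, (hmem y').mpr hy'G⟩, z', ⟨hz'B, (hmem z').mpr hz'G⟩, hvz', ?_⟩
    rw [hy'def, mul_div_assoc, div_self hz'0, mul_one]
  · intro x hx
    obtain ⟨y, ⟨hyB, hyG⟩, z, ⟨hzB, hzG⟩, hvz, rfl⟩ := mem_locAtCentre_iff.mp hx
    replace hyG : ∀ g : G, g • y = y := (hmem y).mp hyG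
    replace hzG : ∀ g : G, g • z = z := (hmem z).mp hzG
    refine ⟨⟨y, hyB, z, hzB, hvz, rfl⟩, (hmem _).mpr fun g => ?_⟩
    rw [div_eq_mul_inv, smul_mul', smul_inv'', hyG g, hzG g]

/-- **"`S₀ˢ` is regular": the fixed local model of a finite group acting with trivial inertia
(modulo its kernel) on a regular local model is regular.** For a finite group `G` of
automorphisms of the field `F` preserving the valuation ring `O` and a `G`-stable subring
`B ⊆ O` whose local ring at the centre `B_{𝔪_O ∩ B}` is regular, such that every `g ∈ G` either
fixes `B` pointwise or moves some element of `B_{𝔪_O ∩ B}` by a unit of `O` (`v(g•x − x) = 0`: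
`g` acts non-trivially on the residue field), the local ring `(B^G)_{𝔪_O ∩ B^G}` of the ring of
invariants is regular: `G` acts on `B_{𝔪 ∩ B}`, whose ring of invariants is `(B^G)_{𝔪 ∩ B^G}`
(`locAtCentre_inf_fixedPoints_eq`), and regularity descends
(`isRegularLocalRing_of_trivial_or_isUnit_smul_sub`). [cite: CossartPiltant2008, proof of Prop. 9.3 (HAL p. 27), "`S₀ⁱ` is local-étale over `S₀ˢ`, so that `S₀ˢ` is regular"] -/
theorem isRegularLocalRing_locAtCentre_inf_fixedPoints
    (hGO : ∀ (g : G) (x : F), x ∈ O → g • x ∈ O)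
    {B : Subring F} (hBO : B ≤ O.toSubring) (hB : ∀ (g : G), ∀ x ∈ B, g • x ∈ B)
    (hI : ∀ g : G, (∀ x ∈ B, g • x = x) ∨
      ∃ x ∈ locAtCentre B O, O.valuation (g • x - x) = 1)
    (hreg : IsRegularLocalRing (locAtCentre B O)) :
    IsRegularLocalRing (locAtCentre (B ⊓ FixedPoints.subring F G) O) := by
  classical
  have hmem : ∀ x : F, x ∈ FixedPoints.subring F G ↔ ∀ g : G, g • x = x := fun x => Iff.rfl
  have hRC : locAtCentre (B ⊓ FixedPoints.subring F G) O ≤ locAtCentre B O :=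
    locAtCentre_mono O inf_le_left
  letI : Algebra (locAtCentre (B ⊓ FixedPoints.subring F G) O) (locAtCentre B O) :=
    (Subring.inclusion hRC).toAlgebra
  letI act : MulSemiringAction G (locAtCentre B O) :=
    { smul := fun g x => ⟨g • (x : F), smul_mem_locAtCentre_of_stable O hGO hB g x.2⟩
      one_smul := fun x => Subtype.ext (one_smul G (x : F))
      mul_smul := fun g h x => Subtype.ext (mul_smul g h (x : F))
      smul_zero := fun g => Subtype.ext (smul_zero g)
      smul_add := fun g x y => Subtype.ext (smul_add g (x : F) y)
      smul_one := fun g => Subtype.ext (smul_one g)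
      smul_mul := fun g x y => Subtype.ext (smul_mul' g (x : F) y) }
  have hsmul : ∀ (g : G) (x : locAtCentre B O), ((g • x : locAtCentre B O) : F) = g • (x : F) :=
    fun _ _ => rfl
  haveI := hreg
  refine isRegularLocalRing_of_trivial_or_isUnit_smul_sub (G := G)
    (R := locAtCentre (B ⊓ FixedPoints.subring F G) O) (C := locAtCentre B O) ?_ ?_ ?_ ?_
  · intro g r
    apply Subtype.ext
    rw [hsmul]
    have hr : (r : F) ∈ locAtCentre B O ⊓ FixedPoints.subring F G := by
      rw [locAtCentre_inf_fixedPoints_eq O hGO hB]; exact r.2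
    exact ((hmem _).mp hr.2) g
  · intro c hc
    have h1 : (c : F) ∈ locAtCentre B O ⊓ FixedPoints.subring F G :=
      ⟨c.2, (hmem _).mpr fun g => by rw [← hsmul]; exact congrArg Subtype.val (hc g)⟩
    rw [locAtCentre_inf_fixedPoints_eq O hGO hB] at h1
    exact ⟨⟨c, h1⟩, rfl⟩
  · intro a b h
    have h' : ((Subring.inclusion hRC a : locAtCentre B O) : F) = (Subring.inclusion hRC b : F) :=
      congrArg (fun x : locAtCentre B O => (x : F)) h
    exact Subtype.ext h'
  · intro g
    rcases hI g with h | ⟨x, hx, hv⟩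
    · left
      intro c
      apply Subtype.ext
      rw [hsmul]
      obtain ⟨y, hy, z, hz, -, hc⟩ := mem_locAtCentre_iff.mp c.2
      rw [hc, div_eq_mul_inv, smul_mul', smul_inv'', h y hy, h z hz]
    · right
      refine ⟨⟨x, hx⟩, isUnit_locAtCentre_of_valuation_eq_one O hBO _ ?_⟩
      simpa only [AddSubgroupClass.coe_sub, hsmul] using hv

end FixedModel

end Literature.AlgebraicGeometry.Resolution

end
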